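import Summits.AtomisticToContinuum.HydrodynamicLimit.Theorems.CollisionIsometryCLTMacroClosureStubBlockMGFCochran
import HarnessLib

/-!
# Crux `NearConstantShortTimeHL` (stmt-AtomisticToContinuum-12502), line `small-tilt-domination` —
# stub `ball_gaussian_estimate`, part A: Chernoff bounds for one ball of independent Gaussian velocities

Support file (`--supports stmt-AtomisticToContinuum-12502`; registered helper `chernoff_energySum`) for the
registered stub `ball_gaussian_estimate` (the unfolded `stub_ballGaussianEstimate : BallGaussianEstimate`,
proved in `…BallGaussianEstimate.lean`). Contents: (§1) an exponential moment from a geometric tail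
(`e^{γT} ≤ Σⱼ 𝟙{j ≤ T} e^{γ(j+1)}`, `lintegral_tsum`, geometric series) and the splitting
`∫ e^{γ(A+B+C)} ≤ ∫ e^{3γA} + ∫ e^{3γB} + ∫ e^{3γC}`; (§2) the Chernoff bound for an independent sum under a
finite product measure (Tonelli for products + Markov); (§3) the exact one-particle Gaussian integrals
(`lintegral_exp_quad_gaussMeasure`): `E e^{λY} = (1 − λθ)^{−3/2} e^{−3λθ/2} exp(θλ²‖u‖²/(2(1 − λθ)))` for the
centred kinetic energy `Y = ‖v‖²/2 − ‖u‖²/2 − 3θ/2` under `N(u, θI₃)`, whence `E e^{λY} ≤ e^{4M³λ²}` for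
`|λ| ≤ 1/(2M)` in the box `M⁻¹ ≤ θ ≤ M`, `‖u‖ ≤ M` (`−log(1 − x) ≤ x + 2x²` for `|x| ≤ 1/2`), and
`E e^{t(v_l − u_l)} = e^{θt²/2}`; (§4) the two-sided Chernoff bounds for the ball of `k ≤ Rν` particles under
`⊗ᵢ N(uᵢ, θᵢ I₃)`: `P(x ≤ ±Σᵢ Yᵢ) ≤ exp(−tx + 4M³Rν t²)` (`0 ≤ t ≤ 1/(2M)`) and
`P(x ≤ ±(Σᵢ(vᵢ − uᵢ))_l) ≤ exp(−tx + RMν t²/2)` (`t ≥ 0`).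
-/

noncomputable section

open MeasureTheory ProbabilityTheory Filter Set Topology
open scoped ENNReal BigOperators InnerProductSpace

namespace Summit.AtomisticToContinuum.HydrodynamicLimit.Theorems.NearConstantShortTimeHL

open Literature.MathematicalPhysics.KineticTheory Literature.Analysis.FluidPDE
open Summit.AtomisticToContinuum.HydrodynamicLimit.Theorems.MacroClosureLine.Barycentric
  (lintegral_exp_quad_gaussMeasure)

/-! ## §1 Exponential moments from geometric tails -/

/-- `exp(a + b + c) ≤ exp(3a) + exp(3b) + exp(3c)`. [folklore] -/
theorem exp_add_three_le (a b c : ℝ) :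
    Real.exp (a + b + c) ≤ Real.exp (3 * a) + Real.exp (3 * b) + Real.exp (3 * c) := by
  have ha := Real.exp_pos (3 * a)
  have hb := Real.exp_pos (3 * b)
  have hc := Real.exp_pos (3 * c)
  rcases le_total b a with hab | hab <;> rcases le_total c a with hac | hac <;>
    rcases le_total c b with hbc | hbc
  all_goals first
    | linarith [Real.exp_le_exp.2 (show a + b + c ≤ 3 * a by linarith)]
    | linarith [Real.exp_le_exp.2 (show a + b + c ≤ 3 * b by linarith)]
    | linarith [Real.exp_le_exp.2 (show a + b + c ≤ 3 * c by linarith)]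

/-- **Splitting an exponential moment of a sum of three terms**:
`∫ exp(γ(A + B + C)) ≤ ∫ exp(3γA) + ∫ exp(3γB) + ∫ exp(3γC)` (`A`, `B` measurable). [folklore] -/
theorem lintegral_exp_mul_add_three_le {α : Type*} [MeasurableSpace α] (μ : Measure α)
    {A B C : α → ℝ} (hA : Measurable A) (hB : Measurable B) (γ : ℝ) :
    ∫⁻ x, ENNReal.ofReal (Real.exp (γ * (A x + B x + C x))) ∂μ ≤
      ∫⁻ x, ENNReal.ofReal (Real.exp (3 * γ * A x)) ∂μ +
        ∫⁻ x, ENNReal.ofReal (Real.exp (3 * γ * B x)) ∂μ +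
        ∫⁻ x, ENNReal.ofReal (Real.exp (3 * γ * C x)) ∂μ := by
  have hA' : Measurable fun x => ENNReal.ofReal (Real.exp (3 * γ * A x)) :=
    (hA.const_mul _).exp.ennreal_ofReal
  have hAB : Measurable fun x => ENNReal.ofReal (Real.exp (3 * γ * A x)) +
      ENNReal.ofReal (Real.exp (3 * γ * B x)) := hA'.add (hB.const_mul _).exp.ennreal_ofReal
  rw [← lintegral_add_left hA', ← lintegral_add_left hAB]
  refine lintegral_mono fun x => ?_
  rw [← ENNReal.ofReal_add (Real.exp_pos _).le (Real.exp_pos _).le,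
    ← ENNReal.ofReal_add (add_nonneg (Real.exp_pos _).le (Real.exp_pos _).le) (Real.exp_pos _).le]
  refine ENNReal.ofReal_le_ofReal ?_
  have h := exp_add_three_le (γ * A x) (γ * B x) (γ * C x)
  have e0 : γ * (A x + B x + C x) = γ * A x + γ * B x + γ * C x := by ring
  rw [e0, mul_assoc, mul_assoc, mul_assoc]
  exact h

/-- **Exponential moment from a geometric tail.** On a probability space, if `T ≥ 0` is measurable
and `P(j ≤ T) ≤ D e^{-cj}` for all integers `j ≥ 1` (`c > 0`, `D ≥ 1`), then for `0 ≤ γ ≤ c/2`,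
`∫ exp(γ T) dP ≤ D e^{c/2} (1 + 2/c)` (`e^{γT} ≤ Σⱼ 𝟙{j ≤ T} e^{γ(j+1)}`, `lintegral_tsum`, geometric
series). [folklore] -/
theorem lintegral_exp_mul_le_of_geometric_tail {α : Type*} [MeasurableSpace α] (P : Measure α)
    [IsProbabilityMeasure P] {T : α → ℝ} (hT : Measurable T) (hT0 : ∀ x, 0 ≤ T x) {c D : ℝ}
    (hc : 0 < c) (hD : 1 ≤ D)
    (htail : ∀ j : ℕ, 1 ≤ j → P {x | (j : ℝ) ≤ T x} ≤ ENNReal.ofReal (D * Real.exp (-(c * j))))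
    {γ : ℝ} (hγ0 : 0 ≤ γ) (hγc : γ ≤ c / 2) :
    ∫⁻ x, ENNReal.ofReal (Real.exp (γ * T x)) ∂P ≤
      ENNReal.ofReal (D * Real.exp (c / 2) * (1 + 2 / c)) := by
  have hmeas : ∀ j : ℕ, MeasurableSet {x | (j : ℝ) ≤ T x} := fun j =>
    measurableSet_le measurable_const hT
  set g : ℕ → α → ℝ≥0∞ := fun j =>
    {x | (j : ℝ) ≤ T x}.indicator fun _ => ENNReal.ofReal (Real.exp (γ * (j + 1))) with hg
  -- pointwise discretisation
  have hpt : ∀ x, ENNReal.ofReal (Real.exp (γ * T x)) ≤ ∑' j, g j x := by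
    intro x
    set n := ⌊T x⌋₊ with hn
    have h1 : (n : ℝ) ≤ T x := Nat.floor_le (hT0 x)
    have h2 : T x < n + 1 := Nat.lt_floor_add_one (T x)
    calc ENNReal.ofReal (Real.exp (γ * T x)) ≤ ENNReal.ofReal (Real.exp (γ * (n + 1))) :=
          ENNReal.ofReal_le_ofReal (Real.exp_le_exp.2 (mul_le_mul_of_nonneg_left h2.le hγ0))
      _ = g n x := by
          simp only [hg]
          rw [Set.indicator_of_mem (show x ∈ {x | (n : ℝ) ≤ T x} from h1)]
      _ ≤ ∑' j, g j x := ENNReal.le_tsum n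
  -- the tail bound, all `j`
  have htail' : ∀ j : ℕ, P {x | (j : ℝ) ≤ T x} ≤ ENNReal.ofReal (D * Real.exp (-(c * j))) := by
    intro j
    rcases Nat.eq_zero_or_pos j with rfl | hj
    · simp only [CharP.cast_eq_zero, mul_zero, neg_zero, Real.exp_zero, mul_one]
      exact prob_le_one.trans (ENNReal.one_le_ofReal.2 hD)
    · exact htail j hj
  set r : ℝ≥0∞ := ENNReal.ofReal (Real.exp (-(c / 2))) with hr
  have hterm : ∀ j : ℕ, ∫⁻ x, g j x ∂P ≤ ENNReal.ofReal (D * Real.exp γ) * r ^ j := by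
    intro j
    simp only [hg]
    rw [lintegral_indicator_const (hmeas j)]
    calc ENNReal.ofReal (Real.exp (γ * (j + 1))) * P {x | (j : ℝ) ≤ T x}
        ≤ ENNReal.ofReal (Real.exp (γ * (j + 1))) * ENNReal.ofReal (D * Real.exp (-(c * j))) :=
          mul_le_mul' le_rfl (htail' j)
      _ = ENNReal.ofReal (Real.exp (γ * (j + 1)) * (D * Real.exp (-(c * j)))) :=
          (ENNReal.ofReal_mul (Real.exp_pos _).le).symm
      _ ≤ ENNReal.ofReal (D * Real.exp γ * Real.exp (-(c / 2)) ^ j) := by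
          refine ENNReal.ofReal_le_ofReal ?_
          rw [← Real.exp_nat_mul, mul_assoc, ← Real.exp_add, mul_comm (Real.exp _) (D * _), mul_assoc,
            ← Real.exp_add]
          refine mul_le_mul_of_nonneg_left (Real.exp_le_exp.2 ?_) (by linarith)
          have hj : (0 : ℝ) ≤ j := Nat.cast_nonneg j
          nlinarith
      _ = ENNReal.ofReal (D * Real.exp γ) * r ^ j := by
          rw [ENNReal.ofReal_mul (by positivity), ENNReal.ofReal_pow (Real.exp_pos _).le]
  have hr1 : Real.exp (-(c / 2)) < 1 := Real.exp_lt_one_iff.2 (by linarith)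
  -- `(1 - e^{-c/2})⁻¹ ≤ 1 + 2/c`
  have hgeom : (1 - r)⁻¹ ≤ ENNReal.ofReal (1 + 2 / c) := by
    have hpos : 0 < 1 - Real.exp (-(c / 2)) := by linarith
    rw [hr, ← ENNReal.ofReal_one, ← ENNReal.ofReal_sub _ (Real.exp_pos _).le,
      ← ENNReal.ofReal_inv_of_pos hpos]
    refine ENNReal.ofReal_le_ofReal ?_
    have hlow : c / (2 + c) ≤ 1 - Real.exp (-(c / 2)) := by
      have h1 : c / 2 + 1 ≤ Real.exp (c / 2) := Real.add_one_le_exp _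
      have h2 : Real.exp (-(c / 2)) * Real.exp (c / 2) = 1 := by
        rw [← Real.exp_add, neg_add_cancel, Real.exp_zero]
      have h3 : Real.exp (-(c / 2)) ≤ 1 / (c / 2 + 1) := by
        rw [le_div_iff₀ (by linarith)]
        nlinarith [Real.exp_pos (-(c / 2))]
      have h4 : c / (2 + c) = 1 - 1 / (c / 2 + 1) := by
        field_simp
        ring
      linarith
    calc (1 - Real.exp (-(c / 2)))⁻¹ ≤ (c / (2 + c))⁻¹ := inv_anti₀ (by positivity) hlow
      _ = 1 + 2 / c := by
          field_simp
          ring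
  calc ∫⁻ x, ENNReal.ofReal (Real.exp (γ * T x)) ∂P ≤ ∫⁻ x, ∑' j, g j x ∂P := lintegral_mono hpt
    _ = ∑' j, ∫⁻ x, g j x ∂P :=
        lintegral_tsum fun j => (measurable_const.indicator (hmeas j)).aemeasurable
    _ ≤ ∑' j, ENNReal.ofReal (D * Real.exp γ) * r ^ j := ENNReal.tsum_le_tsum hterm
    _ = ENNReal.ofReal (D * Real.exp γ) * (1 - r)⁻¹ := by
        rw [ENNReal.tsum_mul_left, ENNReal.tsum_geometric]
    _ ≤ ENNReal.ofReal (D * Real.exp (c / 2)) * ENNReal.ofReal (1 + 2 / c) := by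
        gcongr
    _ = ENNReal.ofReal (D * Real.exp (c / 2) * (1 + 2 / c)) :=
        (ENNReal.ofReal_mul (by positivity)).symm

/-! ## §2 Chernoff bounds under a finite product measure -/

/-- **Chernoff bound for an independent sum.** Under `⊗ᵢ μᵢ`, if `∫ exp(t fᵢ) dμᵢ ≤ exp(cᵢ)` for a
fixed `t ≥ 0`, then `P(x ≤ Σᵢ fᵢ(vᵢ)) ≤ exp(−tx + Σᵢ cᵢ)` (Tonelli for products
`lintegral_fintype_prod_eq_prod'` and Markov's inequality). [folklore] -/
theorem measure_le_sum_pi_le {ι E : Type*} [Fintype ι] [MeasurableSpace E] (μ : ι → Measure E)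
    [∀ i, SigmaFinite (μ i)] {f : ι → E → ℝ} (hf : ∀ i, Measurable (f i)) {t : ℝ} (ht : 0 ≤ t)
    {c : ι → ℝ}
    (hmgf : ∀ i, ∫⁻ y, ENNReal.ofReal (Real.exp (t * f i y)) ∂(μ i) ≤ ENNReal.ofReal (Real.exp (c i)))
    (x : ℝ) :
    Measure.pi μ {v | x ≤ ∑ i, f i (v i)} ≤ ENNReal.ofReal (Real.exp (-(t * x) + ∑ i, c i)) := by
  set G : (ι → E) → ℝ≥0∞ := fun v => ENNReal.ofReal (Real.exp (t * ∑ i, f i (v i))) with hG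
  have hGm : Measurable G := by
    refine ENNReal.measurable_ofReal.comp (Real.measurable_exp.comp (measurable_const.mul ?_))
    exact Finset.measurable_sum _ fun i _ => (hf i).comp (measurable_pi_apply i)
  have hGprod : ∀ v, G v = ∏ i, ENNReal.ofReal (Real.exp (t * f i (v i))) := fun v => by
    simp only [hG, Finset.mul_sum, Real.exp_sum]
    exact ENNReal.ofReal_prod_of_nonneg fun i _ => (Real.exp_pos _).le
  have hint : ∫⁻ v, G v ∂(Measure.pi μ) ≤ ENNReal.ofReal (Real.exp (∑ i, c i)) := by
    calc ∫⁻ v, G v ∂(Measure.pi μ)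
        = ∫⁻ v, ∏ i, ENNReal.ofReal (Real.exp (t * f i (v i))) ∂(Measure.pi μ) :=
          lintegral_congr fun v => hGprod v
      _ = ∏ i, ∫⁻ y, ENNReal.ofReal (Real.exp (t * f i y)) ∂(μ i) :=
          lintegral_fintype_prod_eq_prod' μ
            (f := fun i y => ENNReal.ofReal (Real.exp (t * f i y)))
            fun i => ((hf i).const_mul t).exp.ennreal_ofReal
      _ ≤ ∏ i, ENNReal.ofReal (Real.exp (c i)) := Finset.prod_le_prod' fun i _ => hmgf i
      _ = ENNReal.ofReal (Real.exp (∑ i, c i)) := by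
          rw [Real.exp_sum, ENNReal.ofReal_prod_of_nonneg fun i _ => (Real.exp_pos _).le]
  have hsub : {v : ι → E | x ≤ ∑ i, f i (v i)} ⊆ {v | ENNReal.ofReal (Real.exp (t * x)) ≤ G v} :=
    fun v hv => ENNReal.ofReal_le_ofReal (Real.exp_le_exp.2 (mul_le_mul_of_nonneg_left hv ht))
  have hpos : ENNReal.ofReal (Real.exp (t * x)) ≠ 0 := (ENNReal.ofReal_pos.2 (Real.exp_pos _)).ne'
  calc Measure.pi μ {v | x ≤ ∑ i, f i (v i)}
      ≤ Measure.pi μ {v | ENNReal.ofReal (Real.exp (t * x)) ≤ G v} := measure_mono hsub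
    _ ≤ (∫⁻ v, G v ∂Measure.pi μ) / ENNReal.ofReal (Real.exp (t * x)) :=
        meas_ge_le_lintegral_div hGm.aemeasurable hpos ENNReal.ofReal_ne_top
    _ ≤ ENNReal.ofReal (Real.exp (∑ i, c i)) / ENNReal.ofReal (Real.exp (t * x)) := by
        gcongr
    _ = ENNReal.ofReal (Real.exp (-(t * x) + ∑ i, c i)) := by
        rw [← ENNReal.ofReal_div_of_pos (Real.exp_pos _), ← Real.exp_sub]
        ring_nf

/-! ## §3 One-particle Gaussian integrals -/

/-- **Exact exponential moment of the centred kinetic energy** under `N(u, θ I₃)`: for `θ > 0` and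
`λθ < 1`, `E exp(λ(‖v‖²/2 − ‖u‖²/2 − 3θ/2)) = (1 − λθ)^{−3/2} exp(−3λθ/2 + θλ²‖u‖²/(2(1 − λθ)))`
(`lintegral_exp_quad_gaussMeasure` with `A = −λ/2`, `b = 0`). [folklore] -/
theorem lintegral_exp_mul_energy_gaussMeasure (u : V3) {θ lam : ℝ} (hθ : 0 < θ) (hl : lam * θ < 1) :
    ∫⁻ v, ENNReal.ofReal (Real.exp (lam * (‖v‖ ^ 2 / 2 - ‖u‖ ^ 2 / 2 - 3 / 2 * θ))) ∂(gaussMeasure u θ) =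
      ENNReal.ofReal ((1 - lam * θ) ^ (-(3 : ℝ) / 2) *
        Real.exp (-(3 / 2 * (lam * θ)) + θ * (lam ^ 2 * ‖u‖ ^ 2) / (2 * (1 - lam * θ)))) := by
  have hA : -1 < 2 * (-(lam / 2)) * θ := by linarith
  have h := lintegral_exp_quad_gaussMeasure u 0 (-(lam * (‖u‖ ^ 2 / 2 + 3 / 2 * θ))) hθ hA
  have hpt : ∀ v : V3, lam * (‖v‖ ^ 2 / 2 - ‖u‖ ^ 2 / 2 - 3 / 2 * θ) =
      -(-(lam / 2)) * ‖v‖ ^ 2 + inner ℝ (0 : V3) v + -(lam * (‖u‖ ^ 2 / 2 + 3 / 2 * θ)) := by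
    intro v
    rw [inner_zero_left]
    ring
  simp_rw [hpt]
  have e1 : 1 + 2 * -(lam / 2) * θ = 1 - lam * θ := by ring
  rw [h, e1]
  congr 1; congr 1; congr 1
  rw [inner_zero_left, norm_sub_rev, sub_zero, norm_smul, mul_pow, Real.norm_eq_abs, sq_abs]
  ring

/-- `−log(1 − x) ≤ x + 2x²` for `|x| ≤ 1/2` (`|x + log(1 − x)| ≤ |x|²/(1 − |x|)`). [folklore] -/
theorem neg_log_one_sub_le {x : ℝ} (hx : |x| ≤ 1 / 2) : -Real.log (1 - x) ≤ x + 2 * x ^ 2 := by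
  have h := Real.abs_log_sub_add_sum_range_le (show |x| < 1 by linarith) 1
  simp only [Finset.sum_range_one, Nat.cast_zero, zero_add, pow_one, div_one] at h
  have h1 : |x| ^ (1 + 1) / (1 - |x|) ≤ 2 * x ^ 2 := by
    rw [show |x| ^ (1 + 1) = x ^ 2 by rw [pow_succ, pow_one, ← sq, sq_abs], div_le_iff₀ (by linarith)]
    nlinarith [sq_nonneg x, abs_nonneg x]
  have h2 := (abs_le.1 (h.trans h1)).1
  linarith

/-- **Sub-Gaussian bound for the centred kinetic energy in the box**: for `M ≥ 1`, `M⁻¹ ≤ θ ≤ M`,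
`‖u‖ ≤ M` and `|λ| ≤ 1/(2M)`, `E exp(λ(‖v‖²/2 − ‖u‖²/2 − 3θ/2)) ≤ exp(4M³λ²)`. [folklore] -/
theorem lintegral_exp_mul_energy_gaussMeasure_le {M : ℝ} (hM : 1 ≤ M) (u : V3) {θ lam : ℝ}
    (hθ1 : M⁻¹ ≤ θ) (hθ2 : θ ≤ M) (hu : ‖u‖ ≤ M) (hl : |lam| ≤ 1 / (2 * M)) :
    ∫⁻ v, ENNReal.ofReal (Real.exp (lam * (‖v‖ ^ 2 / 2 - ‖u‖ ^ 2 / 2 - 3 / 2 * θ))) ∂(gaussMeasure u θ) ≤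
      ENNReal.ofReal (Real.exp (4 * M ^ 3 * lam ^ 2)) := by
  have hM0 : 0 < M := by linarith
  have hθ : 0 < θ := lt_of_lt_of_le (inv_pos.2 hM0) hθ1
  have hx : |lam * θ| ≤ 1 / 2 := by
    rw [abs_mul, abs_of_pos hθ]
    calc |lam| * θ ≤ 1 / (2 * M) * M := mul_le_mul hl hθ2 hθ.le (by positivity)
      _ = 1 / 2 := by field_simp
  have hx1 : lam * θ ≤ 1 / 2 := (le_abs_self _).trans hx
  have hx2 : -(1 / 2) ≤ lam * θ := (abs_le.1 hx).1
  rw [lintegral_exp_mul_energy_gaussMeasure u hθ (by linarith)]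
  refine ENNReal.ofReal_le_ofReal ?_
  have hs : 0 < 1 - lam * θ := by linarith
  rw [Real.rpow_def_of_pos hs, ← Real.exp_add]
  refine Real.exp_le_exp.2 ?_
  have hlog := neg_log_one_sub_le hx
  have hfrac : θ * (lam ^ 2 * ‖u‖ ^ 2) / (2 * (1 - lam * θ)) ≤ θ * (lam ^ 2 * ‖u‖ ^ 2) := by
    rw [div_le_iff₀ (by linarith)]
    have h0 : 0 ≤ θ * (lam ^ 2 * ‖u‖ ^ 2) := by positivity
    nlinarith
  have hθ2' : θ ^ 2 ≤ M ^ 2 := pow_le_pow_left₀ hθ.le hθ2 2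
  have hu2 : ‖u‖ ^ 2 ≤ M ^ 2 := pow_le_pow_left₀ (norm_nonneg _) hu 2
  have hM2 : M ^ 2 ≤ M ^ 3 := by nlinarith
  have hl2 : 0 ≤ lam ^ 2 := sq_nonneg _
  calc Real.log (1 - lam * θ) * (-(3 : ℝ) / 2) +
        (-(3 / 2 * (lam * θ)) + θ * (lam ^ 2 * ‖u‖ ^ 2) / (2 * (1 - lam * θ)))
      ≤ 3 * (lam * θ) ^ 2 + θ * (lam ^ 2 * ‖u‖ ^ 2) := by nlinarith
    _ = lam ^ 2 * (3 * θ ^ 2 + θ * ‖u‖ ^ 2) := by ring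
    _ ≤ lam ^ 2 * (3 * M ^ 2 + M * M ^ 2) := by
        refine mul_le_mul_of_nonneg_left ?_ hl2
        nlinarith [mul_le_mul hθ2 hu2 (sq_nonneg _) hM0.le]
    _ ≤ 4 * M ^ 3 * lam ^ 2 := by nlinarith

/-- **Exact exponential moment of a centred velocity coordinate** under `N(u, θ I₃)`:
`E exp(t (v_l − u_l)) = exp(θt²/2)` (`lintegral_exp_quad_gaussMeasure` with `A = 0`,
`b = t e_l`). [folklore] -/
theorem lintegral_exp_mul_coord_gaussMeasure (u : V3) {θ : ℝ} (hθ : 0 < θ) (t : ℝ) (l : Fin 3) :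
    ∫⁻ v, ENNReal.ofReal (Real.exp (t * (v l - u l))) ∂(gaussMeasure u θ) =
      ENNReal.ofReal (Real.exp (θ * t ^ 2 / 2)) := by
  have hA : -1 < 2 * (0 : ℝ) * θ := by norm_num
  have h := lintegral_exp_quad_gaussMeasure u (EuclideanSpace.single l t) (-(t * u l)) hθ hA
  have hpt : ∀ v : V3, t * (v l - u l) =
      -(0 : ℝ) * ‖v‖ ^ 2 + inner ℝ (EuclideanSpace.single l t) v + -(t * u l) := by
    intro v
    rw [EuclideanSpace.inner_single_left]
    simp only [conj_trivial]
    ring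
  simp_rw [hpt]
  rw [h]
  congr 1
  rw [EuclideanSpace.inner_single_left, mul_zero, zero_smul, sub_zero]
  simp only [conj_trivial, PiLp.norm_single, Real.norm_eq_abs, sq_abs, zero_mul, add_zero,
    Real.one_rpow, one_mul, sub_zero, mul_one]
  congr 1
  ring

/-! ## §4 The Chernoff bounds for the ball: energy sum and velocity coordinates -/

/-- The energy sum `Σᵢ (‖vᵢ‖²/2 − ‖uᵢ‖²/2 − 3θᵢ/2)` is measurable. [folklore] -/
theorem measurable_energySum {k : ℕ} (u : Fin k → V3) (θ : Fin k → ℝ) :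
    Measurable fun v : Fin k → V3 => ∑ i, (‖v i‖ ^ 2 / 2 - ‖u i‖ ^ 2 / 2 - 3 / 2 * θ i) :=
  Finset.measurable_sum _ fun i _ => by fun_prop

/-- The velocity sum `Σᵢ (vᵢ − uᵢ)` is measurable. [folklore] -/
theorem measurable_velSum {k : ℕ} (u : Fin k → V3) :
    Measurable fun v : Fin k → V3 => ∑ i, (v i - u i) :=
  Finset.measurable_sum _ fun i _ => by fun_prop

/-- The rate `a = min(1/(2M), 1/(8M³R))` is positive and `4M³R·a ≤ 1/2`. [folklore] -/
theorem min_rate_pos_and_le {M R : ℝ} (hM : 1 ≤ M) (hR : 0 < R) :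
    0 < min (1 / (2 * M)) (1 / (8 * M ^ 3 * R)) ∧
      4 * M ^ 3 * R * min (1 / (2 * M)) (1 / (8 * M ^ 3 * R)) ≤ 1 / 2 := by
  have hM0 : 0 < M := by linarith
  refine ⟨lt_min (by positivity) (by positivity), ?_⟩
  calc 4 * M ^ 3 * R * min (1 / (2 * M)) (1 / (8 * M ^ 3 * R))
      ≤ 4 * M ^ 3 * R * (1 / (8 * M ^ 3 * R)) :=
        mul_le_mul_of_nonneg_left (min_le_right _ _) (by positivity)
    _ = 1 / 2 := by
        field_simp
        ring

/-- **Two-sided Chernoff bound for the centred kinetic energy of the ball**: under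
`⊗ᵢ N(uᵢ, θᵢ I₃)` in the box, with `k ≤ Rν` particles and `0 ≤ t ≤ 1/(2M)`,
`P(x ≤ ±Σᵢ Yᵢ) ≤ exp(−tx + 4M³Rν t²)`. [folklore] -/
theorem chernoff_energySum : ∀ {M R ν : ℝ}, 1 ≤ M → ∀ {k : ℕ}, (k : ℝ) ≤ R * ν → ∀ (u : Fin k → V3) (θ : Fin k → ℝ), (∀ i, M⁻¹ ≤ θ i ∧ θ i ≤ M ∧ ‖u i‖ ≤ M) → ∀ {t : ℝ}, 0 ≤ t → t ≤ 1 / (2 * M) → ∀ x : ℝ, Measure.pi (fun i => gaussMeasure (u i) (θ i)) {v | x ≤ ∑ i, (‖v i‖ ^ 2 / 2 - ‖u i‖ ^ 2 / 2 - 3 / 2 * θ i)} ≤ ENNReal.ofReal (Real.exp (-(t * x) + 4 * M ^ 3 * R * ν * t ^ 2)) ∧ Measure.pi (fun i => gaussMeasure (u i) (θ i)) {v | x ≤ -∑ i, (‖v i‖ ^ 2 / 2 - ‖u i‖ ^ 2 / 2 - 3 / 2 * θ i)} ≤ ENNReal.ofReal (Real.exp (-(t * x) + 4 * M ^ 3 *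 R * ν * t ^ 2)) := by
  intro M R ν hM k hk u θ hbox t ht0 ht x
  have hM0 : 0 < M := by linarith
  have habs : |t| ≤ 1 / (2 * M) := by rwa [abs_of_nonneg ht0]
  have habs' : |-t| ≤ 1 / (2 * M) := by rwa [abs_neg]
  have hsum : -(t * x) + ∑ _i : Fin k, 4 * M ^ 3 * t ^ 2 ≤ -(t * x) + 4 * M ^ 3 * R * ν * t ^ 2 := by
    rw [Finset.sum_const, Finset.card_univ, Fintype.card_fin, nsmul_eq_mul]
    have h0 : 0 ≤ 4 * M ^ 3 * t ^ 2 := by positivity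
    nlinarith [mul_le_mul_of_nonneg_right hk h0]
  have hmono := ENNReal.ofReal_le_ofReal (Real.exp_le_exp.2 hsum)
  constructor
  · refine le_trans (measure_le_sum_pi_le (fun i => gaussMeasure (u i) (θ i))
      (f := fun i y => ‖y‖ ^ 2 / 2 - ‖u i‖ ^ 2 / 2 - 3 / 2 * θ i) (fun i => by fun_prop) ht0
      (c := fun _ => 4 * M ^ 3 * t ^ 2) (fun i => ?_) x) hmono
    exact lintegral_exp_mul_energy_gaussMeasure_le hM (u i) (hbox i).1 (hbox i).2.1 (hbox i).2.2
      habs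
  · have hset : {v : Fin k → V3 | x ≤ -∑ i, (‖v i‖ ^ 2 / 2 - ‖u i‖ ^ 2 / 2 - 3 / 2 * θ i)} =
        {v | x ≤ ∑ i, -(‖v i‖ ^ 2 / 2 - ‖u i‖ ^ 2 / 2 - 3 / 2 * θ i)} := by
      ext v
      rw [Set.mem_setOf_eq, Set.mem_setOf_eq, Finset.sum_neg_distrib]
    rw [hset]
    refine le_trans (measure_le_sum_pi_le (fun i => gaussMeasure (u i) (θ i))
      (f := fun i y => -(‖y‖ ^ 2 / 2 - ‖u i‖ ^ 2 / 2 - 3 / 2 * θ i)) (fun i => by fun_prop) ht0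
      (c := fun _ => 4 * M ^ 3 * t ^ 2) (fun i => ?_) x) hmono
    have heq : ∀ y : V3, t * -(‖y‖ ^ 2 / 2 - ‖u i‖ ^ 2 / 2 - 3 / 2 * θ i) =
        -t * (‖y‖ ^ 2 / 2 - ‖u i‖ ^ 2 / 2 - 3 / 2 * θ i) := fun y => by ring
    simp_rw [heq]
    have h := lintegral_exp_mul_energy_gaussMeasure_le hM (u i) (hbox i).1 (hbox i).2.1
      (hbox i).2.2 habs'
    rwa [neg_sq] at h

/-- **Two-sided Chernoff bound for a coordinate of the centred velocity sum**: under
`⊗ᵢ N(uᵢ, θᵢ I₃)` in the box, with `k ≤ Rν` particles and `t ≥ 0`,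
`P(x ≤ ±(Σᵢ (vᵢ − uᵢ))_l) ≤ exp(−tx + RMν t²/2)`. [folklore] -/
theorem chernoff_velCoord {M R ν : ℝ} (hM : 1 ≤ M) {k : ℕ} (hk : (k : ℝ) ≤ R * ν)
    (u : Fin k → V3) (θ : Fin k → ℝ) (hbox : ∀ i, M⁻¹ ≤ θ i ∧ θ i ≤ M ∧ ‖u i‖ ≤ M)
    {t : ℝ} (ht0 : 0 ≤ t) (x : ℝ) (l : Fin 3) :
    Measure.pi (fun i => gaussMeasure (u i) (θ i)) {v | x ≤ (∑ i, (v i - u i)) l} ≤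
        ENNReal.ofReal (Real.exp (-(t * x) + R * M * ν * t ^ 2 / 2)) ∧
      Measure.pi (fun i => gaussMeasure (u i) (θ i)) {v | x ≤ -(∑ i, (v i - u i)) l} ≤
        ENNReal.ofReal (Real.exp (-(t * x) + R * M * ν * t ^ 2 / 2)) := by
  have hM0 : 0 < M := by linarith
  have hθ : ∀ i, 0 < θ i := fun i => lt_of_lt_of_le (inv_pos.2 hM0) (hbox i).1
  have hone : ∀ (i : Fin k) (s : ℝ), ∫⁻ y, ENNReal.ofReal (Real.exp (s * (y l - u i l)))
      ∂(gaussMeasure (u i) (θ i)) ≤ ENNReal.ofReal (Real.exp (M * s ^ 2 / 2)) := by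
    intro i s
    rw [lintegral_exp_mul_coord_gaussMeasure (u i) (hθ i) s l]
    refine ENNReal.ofReal_le_ofReal (Real.exp_le_exp.2 ?_)
    exact div_le_div_of_nonneg_right (mul_le_mul_of_nonneg_right (hbox i).2.1 (sq_nonneg s))
      (by norm_num)
  have hsum : -(t * x) + ∑ _i : Fin k, M * t ^ 2 / 2 ≤ -(t * x) + R * M * ν * t ^ 2 / 2 := by
    rw [Finset.sum_const, Finset.card_univ, Fintype.card_fin, nsmul_eq_mul]
    have h0 : 0 ≤ M * t ^ 2 / 2 := by positivity
    nlinarith [mul_le_mul_of_nonneg_right hk h0]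
  have hmono := ENNReal.ofReal_le_ofReal (Real.exp_le_exp.2 hsum)
  have happ : ∀ v : Fin k → V3, (∑ i, (v i - u i)) l = ∑ i, (v i l - u i l) := fun v => by simp
  have hset1 : {v : Fin k → V3 | x ≤ (∑ i, (v i - u i)) l} = {v | x ≤ ∑ i, (v i l - u i l)} := by
    ext v
    rw [Set.mem_setOf_eq, Set.mem_setOf_eq, happ]
  have hset2 : {v : Fin k → V3 | x ≤ -(∑ i, (v i - u i)) l} =
      {v | x ≤ ∑ i, -(v i l - u i l)} := by
    ext v
    rw [Set.mem_setOf_eq, Set.mem_setOf_eq, happ, Finset.sum_neg_distrib]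
  constructor
  · rw [hset1]
    exact le_trans (measure_le_sum_pi_le (fun i => gaussMeasure (u i) (θ i))
      (f := fun i y => y l - u i l) (fun i => by fun_prop) ht0 (c := fun _ => M * t ^ 2 / 2)
      (fun i => hone i t) x) hmono
  · rw [hset2]
    refine le_trans (measure_le_sum_pi_le (fun i => gaussMeasure (u i) (θ i))
      (f := fun i y => -(y l - u i l)) (fun i => by fun_prop) ht0 (c := fun _ => M * t ^ 2 / 2)
      (fun i => ?_) x) hmono
    have heq : ∀ y : V3, t * -(y l - u i l) = -t * (y l - u i l) := fun y => by ring
    simp_rw [heq]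
    have h := hone i (-t)
    rwa [neg_sq] at h

end Summit.AtomisticToContinuum.HydrodynamicLimit.Theorems.NearConstantShortTimeHL

end
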